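import Summits.HubbardSuperconductivity.HubbardSuperconductivity.Theorems.AnisotropyChordTransferFibre3L2Block

/-!
# Route `AnisotropyChord` / H0 rotor rung, LEVEL 2 row `N₁`: the `RExpr` transcription, part 1 — scalar dictionary, block grid,
and the object `‖Π⁰‖²` (computable layer)

Blueprint: HOME/hubbard-h0-rotor-p2/level2_N1_hat.py (p2 g4; the θ²-hatted, V-free mirror of theory-1 g22's level2_N1.py, validated to
reproduce its numbers exactly) and the design memo LEVEL2-EVAL-DESIGN-g4.md.  Over the Level-2 variable vector of `…Fibre3L2Vars`
(`x₀ = t = θ²`, `x₁ = π²`, `x₂ = ν`, `x₃ = a`, `x₄…x₁₅` the hatted named sums) extended by the auxiliaries `x₁₆ = ε₁/θ²`,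
`x₁₇ = ε_m/θ²` (`ε_m = 1 − cos((M₂+1)θ)`), `x₁₈ = cos(θ/2)` and the block unknowns `ĝ(q) = θ²g(q)` / `t̂(q) = θ²t(q)` (one pair of
indices per point `q` of the grid `|q|∞ ≤ M₂ + 1`, `q ≠ 0`), this file defines — as `RExpr`s of
`Literature.Analysis.ValidatedNumerics.IntervalFunctions` — the manifold scalars (`eps = 1/V`, `eta`, `cs`, `uu = c_sG̃(0)`, `dd`,
`qq`, `S1h`, `sig = θ²‖s‖²`, `F0h = θ²F₂(0)`, `rho`, `kap`), the per-momentum closed parts `ch q = θ²c(q)`, the named tails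
`tnamed q`, `Fh q = θ²F₂(q)`, and the two-sided hatted bracket `P2lo`, `P2hi` of `P̂ = θ⁶·Σ_k F₂(k)³` (`‖Π⁰‖² = P̂/(4π²θ⁴)`):
block `|q|∞ ≤ M₂` termwise, closed outer part by `Pi2ClosedExpansion` (hatted), outer tail by `Pi2OuterBound` (hatted, reduced to
`Ŝ₁,Ŝ₂,Ŝ₃`).  No soundness here (that is `…N1RowExprSound`, hypotheses = PartN41-B §2/§5/§6).
Prover seat `hubbard-h0-rotor-p2` g4; helper for piece A = stmt-HubbardSuperconductivity-23918 of rung 19089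
(`--supports`, helper class).  Nothing here proves superconductivity in the Hubbard model; computable helper definitions of ONE
conditional reduction (the GM₃ ∀L certificate, Level-2 row `N₁`); the rotor TARGET as originally worded stays FALSE (g15 verdict).
Mathlib + the tree only; no sorry.
-/

set_option linter.dupNamespace false
set_option autoImplicit false

open Literature.Analysis.ValidatedNumerics

namespace Summit.HubbardSuperconductivity.HubbardSuperconductivity.Theorems.AnisotropyChord.Transfer.Fibre3.L2.N1

/-! ## Term combinators -/

/-- rational constant. -/
def cst (q : ℚ) : RExpr := .const q
/-- sum of a list of terms. -/
def rsum : List RExpr → RExpr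
  | [] => .const 0
  | [e] => e
  | e :: l => .add e (rsum l)
/-- `e³`. -/
def cube (e : RExpr) : RExpr := .mul (.sq e) e

/-! ## Variables -/

/-- `t = θ²`. -/
def vT : RExpr := .var 0
/-- `π²`. -/
def vPi2 : RExpr := .var 1
/-- `ν`. -/
def vNu : RExpr := .var 2
/-- `a = Δf_nn`. -/
def vA : RExpr := .var 3
/-- `Ŝ₂ = θ⁴S₂`. -/
def vS2 : RExpr := .var 4
/-- `Ŝ₃`. -/
def vS3 : RExpr := .var 5
/-- `Ŝ₄`. -/
def vS4 : RExpr := .var 6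
/-- `T̂10`. -/
def vT10 : RExpr := .var 7
/-- `T̂11`. -/
def vT11 : RExpr := .var 8
/-- `ε₁/θ² ∈ [½ − t/24, ½]`. -/
def vE1 : RExpr := .var 16
/-- `ε_m/θ²`, `ε_m = 1 − cos((M₂+1)θ)`. -/
def vEm : RExpr := .var 17

/-- the block grid `{q : |q|∞ ≤ M, q ≠ 0}` as a list (row-major). -/
def gridPts (M : ℕ) : List (ℤ × ℤ) :=
  ((List.range (2 * M + 1)).flatMap fun i => (List.range (2 * M + 1)).map fun j =>
    (((i : ℤ) - M), ((j : ℤ) - M))).filter fun q => q ≠ (0, 0)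

/-- position of `q` in `gridPts M` (junk if absent). -/
def gridIdx (M : ℕ) (q : ℤ × ℤ) : ℕ := (gridPts M).findIdx (· == q)

/-- the variable of `ĝ(q)`, grid `|q|∞ ≤ M`. -/
def vG (M : ℕ) (q : ℤ × ℤ) : RExpr := .var (19 + gridIdx M q)
/-- the variable of `t̂(q)` (un-named `q`), grid `|q|∞ ≤ M`. -/
def vTt (M : ℕ) (q : ℤ × ℤ) : RExpr := .var (19 + (gridPts M).length + gridIdx M q)

/-! ## The scalar dictionary (PartN41-A, hatted) -/

/-- `ε = 1/V = t/(4π²)`. -/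
def eps : RExpr := .mul vT (.inv (.mul (cst 4) vPi2))
/-- `η = π²ν`. -/
def eta : RExpr := .mul vPi2 vNu
/-- `c_s = 4η(1 + aε)`. -/
def cs : RExpr := .mul (.mul (cst 4) eta) (.add (cst 1) (.mul vA eps))
/-- `u = c_s G̃(0) = 1 − a + aε`. -/
def uu : RExpr := .add (.sub (cst 1) vA) (.mul vA eps)
/-- `d = a²`. -/
def dd : RExpr := .sq vA
/-- `q = a² + 2ηa`. -/
def qq : RExpr := .add dd (.mul (.mul (cst 2) eta) vA)
/-- `Ŝ₁ = tS₁ = 4π²u/c_s`. -/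
def S1h : RExpr := .mul (.mul (.mul (cst 4) vPi2) uu) (.inv cs)
/-- `σ̂ = t‖s‖² = (c_s²Ŝ₂ + a²t²)/(4π²)`. -/
def sig : RExpr := .mul (.add (.mul (.sq cs) vS2) (.mul dd (.sq vT))) (.inv (.mul (cst 4) vPi2))
/-- `F̂(0) = tF₂(0) = 4π² + t(2a − a²) + σ̂`. -/
def F0h : RExpr := .add (.add (.mul (cst 4) vPi2) (.mul vT (.sub (.mul (cst 2) vA) dd))) sig
/-- `ρ_M = (2ε̂_m − ν)/(2ε̂_m − 4ν)`. -/
def rho : RExpr := .mul (.sub (.mul (cst 2) vEm) vNu) (.inv (.sub (.mul (cst 2) vEm) (.mul (cst 4) vNu)))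
/-- `κ̂ = 4c_s u ρ`. -/
def kap : RExpr := .mul (.mul (.mul (cst 4) cs) uu) rho

/-! ## Per-momentum closed parts and the block -/

/-- `ĉ(q) = tc(q) = −(2c_sĝ(q) + a²t)`. -/
def ch (M : ℕ) (q : ℤ × ℤ) : RExpr := .neg (.add (.mul (.mul (cst 2) cs) (vG M q)) (.mul dd vT))
/-- `|c|̂ = 2c_sĝ + a²t`. -/
def ach (M : ℕ) (q : ℤ × ℤ) : RExpr := .add (.mul (.mul (cst 2) cs) (vG M q)) (.mul dd vT)
/-- is `q` named (`|q|∞ = 1`)? -/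
def isNamed (q : ℤ × ℤ) : Bool := decide (q ≠ (0, 0)) && decide (q.1.natAbs ≤ 1) && decide (q.2.natAbs ≤ 1)
/-- `t̂(q)` at a named `q`: `(c_s²T̂(q) − 2ac_sĝ(q)t)/(4π²)`, `T̂ = T̂10` on the axes, `T̂11` on the diagonals. -/
def tnamed (M : ℕ) (q : ℤ × ℤ) : RExpr :=
  .mul (.sub (.mul (.sq cs) (if q.1.natAbs + q.2.natAbs = 1 then vT10 else vT11))
             (.mul (.mul (.mul (.mul (cst 2) vA) cs) (vG M q)) vT))
       (.inv (.mul (cst 4) vPi2))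
/-- `F̂(q) = tF₂(q)` for `q ≠ 0`: closed + named tail, or closed + unknown tail. -/
def Fh (M : ℕ) (q : ℤ × ℤ) : RExpr := if isNamed q then .add (ch M q) (tnamed M q) else .add (ch M q) (vTt M q)

/-! ## The object `P̂ = t³Σ_k F₂(k)³` -/

/-- the hatted closed full sum `t³Σ_{k≠0} c(k)³ = −(8c_s³Ŝ₃ + 12c_s²a²tŜ₂ + 6c_sa⁴t²Ŝ₁ + a⁶t²(4π² − t))` (`Pi2ClosedExpansion`). -/
def P2closedFull : RExpr :=
  .neg (rsum [ .mul (.mul (cst 8) (cube cs)) vS3,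
    .mul (.mul (.mul (.mul (cst 12) (.sq cs)) dd) vT) vS2,
    .mul (.mul (.mul (.mul (cst 6) cs) (.sq dd)) (.sq vT)) S1h,
    .mul (.mul (cube dd) (.sq vT)) (.sub (.mul (cst 4) vPi2) vT) ])
/-- the hatted tail majorant full sum `3κ(4c_s²Ŝ₃ + 4c_sa²tŜ₂ + a⁴t²Ŝ₁) + 3κ²(2c_sŜ₃ + a²tŜ₂) + κ³Ŝ₃` (`Pi2OuterBound` summed). -/
def P2tailFull : RExpr :=
  rsum [ .mul (.mul (cst 3) kap) (rsum [ .mul (.mul (cst 4) (.sq cs)) vS3, .mul (.mul (.mul (.mul (cst 4) cs) dd) vT) vS2,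
      .mul (.mul (.sq dd) (.sq vT)) S1h ]),
    .mul (.mul (cst 3) (.sq kap)) (rsum [ .mul (.mul (cst 2) cs) vS3, .mul (.mul dd vT) vS2 ]),
    .mul (cube kap) vS3 ]
/-- the per-momentum tail majorant `3κ|c|̂²ĝ + 3κ²|c|̂ĝ² + κ³ĝ³`. -/
def P2tailAt (M : ℕ) (q : ℤ × ℤ) : RExpr :=
  rsum [ .mul (.mul (.mul (cst 3) kap) (.sq (ach M q))) (vG M q), .mul (.mul (.mul (cst 3) (.sq kap)) (ach M q)) (.sq (vG M q)),
    .mul (cube kap) (cube (vG M q)) ]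
/-- the block points `|q|∞ ≤ M₂`, `q ≠ 0`. -/
def block1 (M2 : ℕ) : List (ℤ × ℤ) := gridPts M2
/-- ★ upper hatted bracket of `P̂`: `F̂(0)³ + Σ_{block} F̂(q)³ + (closedFull − Σ_{block} ĉ³) + max(tailFull − Σ_{block} tailAt, 0)`
(grid of unknowns `|q|∞ ≤ M₂ + 1`). -/
def P2hi (M2 : ℕ) : RExpr :=
  let M := M2 + 1
  rsum [ cube F0h, rsum ((block1 M2).map fun q => cube (Fh M q)), P2closedFull,
    .neg (rsum ((block1 M2).map fun q => cube (ch M q))),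
    .max (.sub P2tailFull (rsum ((block1 M2).map fun q => P2tailAt M q))) (cst 0) ]
/-- ★ lower hatted bracket of `P̂`. -/
def P2lo (M2 : ℕ) : RExpr :=
  let M := M2 + 1
  rsum [ cube F0h, rsum ((block1 M2).map fun q => cube (Fh M q)), P2closedFull,
    .neg (rsum ((block1 M2).map fun q => cube (ch M q))),
    .neg (.max (.sub P2tailFull (rsum ((block1 M2).map fun q => P2tailAt M q))) (cst 0)) ]

end Summit.HubbardSuperconductivity.HubbardSuperconductivity.Theorems.AnisotropyChord.Transfer.Fibre3.L2.N1
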